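import Mathlib.Topology.Homotopy.Lifting
import HarnessLib

/-!
# The fibre functor of covering spaces is fully faithful (Hatcher, Props. 1.33–1.34, Thm. 1.38)

Topic `Literature/Topology/CoveringSpaces` — step (A) of the topological Galois correspondence for
covering spaces (abc-iut cell, campaign-L R1, GAP row G-L4t14-R1; classical).  For covering maps
`p₁ : E₁ → X`, `p₂ : E₂ → X` (Mathlib `IsCoveringMap`) a *morphism of covers* is a continuous
`f : E₁ → E₂` with `p₂ ∘ f = p₁`; its *fibre map* `fibreMap f : p₁⁻¹{x} → p₂⁻¹{x}` is equivariant
for Mathlib's monodromy (`IsCoveringMap.monodromy`):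

* `liftPath_map`, `monodromy_fibreMap` — **naturality** (morphisms commute with path lifting and
  monodromy; uniqueness of lifts, Hatcher Prop. 1.34); `fibreMap_id`, `fibreMap_comp`;
* `eq_of_eqOn_fibre` — **faithful**: over a path-connected base two morphisms of covers agreeing
  on ONE fibre are equal;
* `liftOfEquivariant`, `continuous_liftOfEquivariant`, `fibreMap_liftOfEquivariant`,
  `existsUnique_map_of_equivariant` — **full**: over a path-connected, locally path-connected base
  EVERY map `φ : p₁⁻¹{x₀} → p₂⁻¹{x₀}` commuting with the monodromy of the loops at `x₀` is the fibre
  map of a unique morphism of covers (no connectedness assumption on `E₁`; Hatcher's lifting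
  criterion Prop. 1.33 organised fibrewise: `f e` = transport of `φ` along any path from `p₁ e`
  to `x₀`, path-independent by equivariance, continuous because monodromy along a path inside a
  chart of the cover is the local inverse);
* `homeomorphOfEquivariant` — an equivariant BIJECTION of fibres is the fibre map of a
  homeomorphism over `X` (Thm. 1.38: iso classes of covers ↔ iso classes of `π₁`-sets, injective
  half).

Everything is proved; definitions: `fibreMap`, `transport`, `liftOfEquivariant`,
`homeomorphOfEquivariant`.  Essential surjectivity (every `π₁(X, x₀)`-set is a fibre) and the
categorical packaging are sequels in this topic.

## References

* A. Hatcher, *Algebraic Topology*, CUP 2002, §1.3, Props. 1.33, 1.34, Thm. 1.38 and the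
  discussion after it («the functor … to the fibre»), pp. 61–70. [HatcherAT2002]
-/

noncomputable section
open Set Function Topology
open scoped unitInterval

namespace Literature.Topology.CoveringSpaces

namespace CoverMorphism

variable {X E₁ E₂ E₃ : Type*} {p₁ : E₁ → X} {p₂ : E₂ → X} {p₃ : E₃ → X}

/-! ### §1 Fibre maps of morphisms of covers and their naturality -/

/-- The **fibre map** over `x` of a map `f : E₁ → E₂` over `X` (`p₂ ∘ f = p₁`):
`p₁⁻¹{x} → p₂⁻¹{x}`, `e ↦ f e`. [cite: HatcherAT2002, §1.3 Thm. 1.38 (the functor to the fibre)] -/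
def fibreMap (f : E₁ → E₂) (hf : ∀ e, p₂ (f e) = p₁ e) (x : X) (e : p₁ ⁻¹' {x}) : p₂ ⁻¹' {x} :=
  ⟨f e, by rw [mem_preimage, hf, ← mem_preimage]; exact e.2⟩

/-- The fibre map is `f` on points. [cite: HatcherAT2002, §1.3 Thm. 1.38] -/
@[simp] theorem fibreMap_coe (f : E₁ → E₂) (hf : ∀ e, p₂ (f e) = p₁ e) (x : X) (e : p₁ ⁻¹' {x}) :
    (fibreMap f hf x e : E₂) = f e := rfl

/-- Functoriality: the fibre map of the identity. [cite: HatcherAT2002, §1.3 Thm. 1.38] -/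
theorem fibreMap_id (x : X) : fibreMap (p₁ := p₁) id (fun _ ↦ rfl) x = id := by
  funext e; ext; rfl

/-- Functoriality: the fibre map of a composite. [cite: HatcherAT2002, §1.3 Thm. 1.38] -/
theorem fibreMap_comp (f : E₁ → E₂) (hf : ∀ e, p₂ (f e) = p₁ e) (g : E₂ → E₃)
    (hg : ∀ e, p₃ (g e) = p₂ e) (x : X) :
    fibreMap (p₁ := p₁) (p₂ := p₃) (g ∘ f) (fun e ↦ (hg (f e)).trans (hf e)) x =
      fibreMap g hg x ∘ fibreMap f hf x := by
  funext e; ext; rfl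

variable [TopologicalSpace X] [TopologicalSpace E₁] [TopologicalSpace E₂] [TopologicalSpace E₃]

/-- **Morphisms of covers commute with path lifting** (uniqueness of lifts, Hatcher Prop. 1.34):
the lift of `γ` to `E₂` from `f e` is `f ∘` (the lift of `γ` to `E₁` from `e`).
[cite: HatcherAT2002, §1.3 Prop. 1.34] -/
theorem liftPath_map (cov₁ : IsCoveringMap p₁) (cov₂ : IsCoveringMap p₂) {f : E₁ → E₂}
    (hfc : Continuous f) (hf : ∀ e, p₂ (f e) = p₁ e) (γ : C(I, X)) (e : E₁) (he : γ 0 = p₁ e)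
    (t : I) :
    cov₂.liftPath γ (f e) (he.trans (hf e).symm) t = f (cov₁.liftPath γ e he t) := by
  have h : (fun t ↦ f (cov₁.liftPath γ e he t)) = cov₂.liftPath γ (f e) (he.trans (hf e).symm) := by
    refine (cov₂.eq_liftPath_iff (he.trans (hf e).symm)).2
      ⟨hfc.comp (cov₁.liftPath γ e he).continuous, ?_, ?_⟩
    · funext s
      simp only [Function.comp_apply, hf]
      exact congrFun (cov₁.liftPath_lifts γ e he) s
    · simp only [cov₁.liftPath_zero]
  exact (congrFun h t).symm

/-- **Naturality of monodromy**: the fibre maps of a morphism of covers intertwine the monodromies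
along every homotopy class of paths `γ` from `x` to `y`.
[cite: HatcherAT2002, §1.3 Prop. 1.34, Thm. 1.38] -/
theorem monodromy_fibreMap (cov₁ : IsCoveringMap p₁) (cov₂ : IsCoveringMap p₂) {f : E₁ → E₂}
    (hfc : Continuous f) (hf : ∀ e, p₂ (f e) = p₁ e) {x y : X} (γ : Path.Homotopic.Quotient x y)
    (e : p₁ ⁻¹' {x}) :
    cov₂.monodromy γ (fibreMap f hf x e) = fibreMap f hf y (cov₁.monodromy γ e) := by
  obtain ⟨c, rfl⟩ := Path.Homotopic.Quotient.mk_surjective γ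
  ext
  exact liftPath_map cov₁ cov₂ hfc hf c e (c.source.trans e.2.symm) 1

/-! ### §2 Faithfulness: a morphism of covers is determined by one fibre map -/

/-- Monodromy back and forth along `δ` is the identity. [cite: HatcherAT2002, §1.3 Prop. 1.34] -/
theorem monodromy_symm_monodromy (cov : IsCoveringMap p₁) {x y : X}
    (δ : Path.Homotopic.Quotient x y) (e : p₁ ⁻¹' {x}) :
    cov.monodromy δ.symm (cov.monodromy δ e) = e := by
  rw [← cov.monodromy_trans_apply, Path.Homotopic.Quotient.trans_symm, cov.monodromy_refl]; rfl

/-- Monodromy forth and back along `δ` is the identity. [cite: HatcherAT2002, §1.3 Prop. 1.34] -/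
theorem monodromy_monodromy_symm (cov : IsCoveringMap p₁) {x y : X}
    (δ : Path.Homotopic.Quotient x y) (e : p₁ ⁻¹' {y}) :
    cov.monodromy δ (cov.monodromy δ.symm e) = e := by
  rw [← cov.monodromy_trans_apply, Path.Homotopic.Quotient.symm_trans, cov.monodromy_refl]; rfl

/-- **Faithfulness of the fibre functor** (Hatcher Prop. 1.34): over a path-connected base, two
continuous maps `f, g : E₁ → E₂` over `X` between covering spaces which agree on the fibre over one
point `x₀` agree everywhere. [cite: HatcherAT2002, §1.3 Prop. 1.34] -/
theorem eq_of_eqOn_fibre [PathConnectedSpace X] (cov₁ : IsCoveringMap p₁) (cov₂ : IsCoveringMap p₂)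
    {f g : E₁ → E₂} (hfc : Continuous f) (hgc : Continuous g) (hf : ∀ e, p₂ (f e) = p₁ e)
    (hg : ∀ e, p₂ (g e) = p₁ e) (x₀ : X) (h : ∀ e : p₁ ⁻¹' {x₀}, f e = g e) : f = g := by
  funext e
  let δ : Path (p₁ e) x₀ := PathConnectedSpace.somePath (p₁ e) x₀
  let Γ := cov₁.liftPath (δ : C(I, X)) e δ.source
  have hΓ1 : p₁ (Γ 1) = x₀ := (congrFun (cov₁.liftPath_lifts (δ : C(I, X)) e δ.source) 1).trans δ.target
  have key : f ∘ Γ = g ∘ Γ := by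
    refine cov₂.eq_of_comp_eq (hfc.comp Γ.continuous) (hgc.comp Γ.continuous) ?_ 1 (h ⟨Γ 1, hΓ1⟩)
    funext s
    simp only [Function.comp_apply, hf, hg]
  have h0 := congrFun key 0
  simp only [Function.comp_apply] at h0
  rwa [cov₁.liftPath_zero] at h0

/-- Fibrewise form of faithfulness: morphisms of covers with the same fibre map over `x₀` are equal.
[cite: HatcherAT2002, §1.3 Prop. 1.34] -/
theorem eq_of_fibreMap_eq [PathConnectedSpace X] (cov₁ : IsCoveringMap p₁)
    (cov₂ : IsCoveringMap p₂) {f g : E₁ → E₂} (hfc : Continuous f) (hgc : Continuous g)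
    (hf : ∀ e, p₂ (f e) = p₁ e) (hg : ∀ e, p₂ (g e) = p₁ e) (x₀ : X)
    (h : fibreMap f hf x₀ = fibreMap g hg x₀) : f = g :=
  eq_of_eqOn_fibre cov₁ cov₂ hfc hgc hf hg x₀ fun e ↦ congrArg Subtype.val (congrFun h e)

/-! ### §3 Fullness: every equivariant fibre map is the fibre map of a morphism of covers -/

section Full

variable (cov₁ : IsCoveringMap p₁) (cov₂ : IsCoveringMap p₂) {x₀ : X}
  (φ : p₁ ⁻¹' {x₀} → p₂ ⁻¹' {x₀})

/-- Transport of a fibre map `φ` over `x₀` to the fibre over `x` along a path class `δ : x ⇝ x₀`: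
`e ↦ δ⁻¹ · φ (δ · e)`. [cite: HatcherAT2002, §1.3 proof of Prop. 1.33] -/
def transport {x : X} (δ : Path.Homotopic.Quotient x x₀) (e : p₁ ⁻¹' {x}) : p₂ ⁻¹' {x} :=
  cov₂.monodromy δ.symm (φ (cov₁.monodromy δ e))

variable {cov₁ cov₂ φ}

/-- For an equivariant `φ`, the transport is **independent of the path**: two path classes
`δ, δ'` from `x` to `x₀` differ by the loop `δ⁻¹ · δ'` at `x₀`, whose monodromy `φ` respects.
[cite: HatcherAT2002, §1.3 proof of Prop. 1.33 («well-defined … since … `f_*π₁ ⊂ p_*π₁`»)] -/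
theorem transport_eq_transport (hφ : ∀ γ : Path.Homotopic.Quotient x₀ x₀, Semiconj φ (cov₁.monodromy γ) (cov₂.monodromy γ)) {x : X}
    (δ δ' : Path.Homotopic.Quotient x x₀) (e : p₁ ⁻¹' {x}) :
    transport cov₁ cov₂ φ δ e = transport cov₁ cov₂ φ δ' e := by
  unfold transport
  have h1 : cov₁.monodromy δ' e = cov₁.monodromy (δ.symm.trans δ') (cov₁.monodromy δ e) := by
    rw [cov₁.monodromy_trans_apply, monodromy_symm_monodromy]
  rw [h1, (hφ _).eq, cov₂.monodromy_trans_apply]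
  rw [monodromy_symm_monodromy]

/-- On the fibre over `x₀` itself the transport (along any loop) is `φ`.
[cite: HatcherAT2002, §1.3 proof of Prop. 1.33] -/
theorem transport_refl (e : p₁ ⁻¹' {x₀}) :
    transport cov₁ cov₂ φ (Path.Homotopic.Quotient.refl x₀) e = φ e := by
  unfold transport
  have : (Path.Homotopic.Quotient.refl x₀).symm = Path.Homotopic.Quotient.refl x₀ := by
    rw [← Path.Homotopic.Quotient.mk_refl, ← Path.Homotopic.Quotient.mk_symm]
    exact congrArg _ (Path.refl_symm)
  rw [this, cov₁.monodromy_refl, cov₂.monodromy_refl]; rfl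

/-- Transport is compatible with further monodromy: moving the INPUT along `c : x ⇝ x'` moves the
OUTPUT along `c`. [cite: HatcherAT2002, §1.3 proof of Prop. 1.33] -/
theorem transport_monodromy {x x' : X}
    (c : Path.Homotopic.Quotient x x') (δ : Path.Homotopic.Quotient x x₀) (e : p₁ ⁻¹' {x}) :
    transport cov₁ cov₂ φ (c.symm.trans δ) (cov₁.monodromy c e) =
      cov₂.monodromy c (transport cov₁ cov₂ φ δ e) := by
  unfold transport
  rw [cov₁.monodromy_trans_apply, monodromy_symm_monodromy]
  have : (c.symm.trans δ).symm = δ.symm.trans c := by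
    obtain ⟨s, rfl⟩ := Path.Homotopic.Quotient.mk_surjective c
    obtain ⟨d, rfl⟩ := Path.Homotopic.Quotient.mk_surjective δ
    simp only [← Path.Homotopic.Quotient.mk_symm, ← Path.Homotopic.Quotient.mk_trans]
    exact congrArg _ (by rw [Path.trans_symm, Path.symm_symm])
  rw [this, cov₂.monodromy_trans_apply]

/-- The fibre map of a morphism of covers IS equivariant (so `existsUnique_map_of_equivariant` is a
bijection `Hom_X(E₁,E₂) ≃ Hom_{π₁(X,x₀)}(p₁⁻¹{x₀}, p₂⁻¹{x₀})`). [cite: HatcherAT2002, §1.3 Thm. 1.38] -/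
theorem isEquivariant_fibreMap {f : E₁ → E₂} (hfc : Continuous f) (hf : ∀ e, p₂ (f e) = p₁ e) :
    ∀ γ : Path.Homotopic.Quotient x₀ x₀,
      Semiconj (fibreMap f hf x₀) (cov₁.monodromy γ) (cov₂.monodromy γ) :=
  fun γ e ↦ (monodromy_fibreMap cov₁ cov₂ hfc hf γ e).symm

/-- **Monodromy inside a chart**: if `q` is a partial homeomorphism presenting the covering map `p`
(`p = q` as functions, `e ∈ q.source`) and `c` is a path inside `q.target`, then the monodromy of
`c` at `e` is `q.symm` of the endpoint — the lift is `q.symm ∘ c`.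
[cite: HatcherAT2002, §1.3 Prop. 1.30 (local triviality gives the lift)] -/
theorem monodromy_eq_symm_of_subset_target {E : Type*} [TopologicalSpace E] {p : E → X}
    (cov : IsCoveringMap p) (q : OpenPartialHomeomorph E X) (hq : p = q) {e : E}
    (he : e ∈ q.source) {x x' : X} (hx : p e = x) (c : Path x x') (hc : ∀ t, c t ∈ q.target) :
    (cov.monodromy (Path.Homotopic.Quotient.mk c) ⟨e, hx⟩ : E) = q.symm x' := by
  have hΓ : (fun t ↦ q.symm (c t)) = cov.liftPath (c : C(I, X)) e (c.source.trans hx.symm) := by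
    refine (cov.eq_liftPath_iff (c.source.trans hx.symm)).2 ⟨?_, ?_, ?_⟩
    · exact q.continuousOn_symm.comp_continuous c.continuous hc
    · funext t
      simp only [Function.comp_apply]
      rw [congrFun hq (q.symm (c t))]
      exact q.right_inv (hc t)
    · have h0 : q.symm (c 0) = q.symm (q e) := by rw [c.source, ← hx, congrFun hq e]
      rw [h0]
      exact q.left_inv he
  change cov.liftPath (c : C(I, X)) e _ 1 = _
  rw [← hΓ]
  simp only [c.target]

variable [PathConnectedSpace X]

variable (cov₁ cov₂ φ) in
/-- **The lift attached to a fibre map** `φ` over `x₀` (Hatcher's construction in Prop. 1.33,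
fibrewise): `e ↦ δ⁻¹ · φ (δ · e)` for SOME path `δ` from `p₁ e` to `x₀` (here the one chosen by
`PathConnectedSpace.somePath`; independent of the choice for equivariant `φ`,
`liftOfEquivariant_eq_transport`). [cite: HatcherAT2002, §1.3 Prop. 1.33] -/
def liftOfEquivariant (e : E₁) : E₂ :=
  transport cov₁ cov₂ φ (Path.Homotopic.Quotient.mk (PathConnectedSpace.somePath (p₁ e) x₀))
    ⟨e, rfl⟩

/-- The lift lies over `X`: `p₂ ∘ f = p₁`. [cite: HatcherAT2002, §1.3 Prop. 1.33] -/
theorem liftOfEquivariant_spec (e : E₁) : p₂ (liftOfEquivariant cov₁ cov₂ φ e) = p₁ e :=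
  (transport cov₁ cov₂ φ _ ⟨e, rfl⟩).2

/-- The lift may be computed with ANY path class from `p₁ e` to `x₀`.
[cite: HatcherAT2002, §1.3 Prop. 1.33] -/
theorem liftOfEquivariant_eq_transport (hφ : ∀ γ : Path.Homotopic.Quotient x₀ x₀, Semiconj φ (cov₁.monodromy γ) (cov₂.monodromy γ)) (e : E₁)
    (δ : Path.Homotopic.Quotient (p₁ e) x₀) :
    liftOfEquivariant cov₁ cov₂ φ e = transport cov₁ cov₂ φ δ ⟨e, rfl⟩ := by
  unfold liftOfEquivariant
  rw [transport_eq_transport hφ]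

/-- Version of `liftOfEquivariant_eq_transport` for a point presented as a fibre element.
[cite: HatcherAT2002, §1.3 Prop. 1.33] -/
theorem liftOfEquivariant_eq_transport' (hφ : ∀ γ : Path.Homotopic.Quotient x₀ x₀, Semiconj φ (cov₁.monodromy γ) (cov₂.monodromy γ)) {x : X}
    (e : p₁ ⁻¹' {x}) (δ : Path.Homotopic.Quotient x x₀) :
    liftOfEquivariant cov₁ cov₂ φ e = transport cov₁ cov₂ φ δ e := by
  obtain ⟨e, rfl⟩ := e
  exact liftOfEquivariant_eq_transport hφ e δ

/-- **The lift extends `φ`**: on the fibre over `x₀`, `f = φ`. [cite: HatcherAT2002, §1.3 Prop. 1.33] -/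
theorem liftOfEquivariant_apply_fibre (hφ : ∀ γ : Path.Homotopic.Quotient x₀ x₀, Semiconj φ (cov₁.monodromy γ) (cov₂.monodromy γ)) (e : p₁ ⁻¹' {x₀}) :
    liftOfEquivariant cov₁ cov₂ φ e = φ e := by
  rw [liftOfEquivariant_eq_transport' hφ e (Path.Homotopic.Quotient.refl x₀), transport_refl]

/-- The lift commutes with monodromy along every path class `c` of `X`.
[cite: HatcherAT2002, §1.3 Prop. 1.33] -/
theorem liftOfEquivariant_monodromy (hφ : ∀ γ : Path.Homotopic.Quotient x₀ x₀, Semiconj φ (cov₁.monodromy γ) (cov₂.monodromy γ)) {x x' : X}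
    (c : Path.Homotopic.Quotient x x') (e : p₁ ⁻¹' {x}) :
    liftOfEquivariant cov₁ cov₂ φ (cov₁.monodromy c e) =
      cov₂.monodromy c (fibreMap (liftOfEquivariant cov₁ cov₂ φ) liftOfEquivariant_spec x e) := by
  have δ : Path.Homotopic.Quotient x x₀ :=
    Path.Homotopic.Quotient.mk (PathConnectedSpace.somePath (X := X) x x₀)
  rw [liftOfEquivariant_eq_transport' hφ (cov₁.monodromy c e) (c.symm.trans δ),
    transport_monodromy c δ e]
  congr 2
  ext
  exact (liftOfEquivariant_eq_transport' hφ e δ).symm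

/-- **The lift is continuous** (Hatcher Prop. 1.33, continuity step): near `e`, with charts `q₁`
of `p₁` at `e` and `q₂` of `p₂` at `f e` and a path-connected neighbourhood `V` of `p₁ e` inside
both targets, `f = q₂.symm ∘ p₁` on `q₁.source ∩ p₁⁻¹ V` (monodromy along paths in `V`).
[cite: HatcherAT2002, §1.3 Prop. 1.33] -/
theorem continuous_liftOfEquivariant [LocallyPathConnectedSpace X] (hφ : ∀ γ : Path.Homotopic.Quotient x₀ x₀, Semiconj φ (cov₁.monodromy γ) (cov₂.monodromy γ)) :
    Continuous (liftOfEquivariant cov₁ cov₂ φ) := by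
  set f := liftOfEquivariant cov₁ cov₂ φ with hfdef
  refine continuous_iff_continuousAt.2 fun e ↦ ?_
  obtain ⟨q₁, he₁, hq₁⟩ := cov₁.isLocalHomeomorph e
  obtain ⟨q₂, he₂, hq₂⟩ := cov₂.isLocalHomeomorph (f e)
  have hfe : p₂ (f e) = p₁ e := liftOfEquivariant_spec e
  have hT : q₁.target ∩ q₂.target ∈ 𝓝 (p₁ e) := by
    refine Filter.inter_mem (q₁.open_target.mem_nhds ?_) (q₂.open_target.mem_nhds ?_)
    · rw [hq₁]; exact q₁.map_source he₁
    · rw [← hfe, hq₂]; exact q₂.map_source he₂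
  obtain ⟨V, ⟨hVo, hxV, hVpc⟩, hVT⟩ := (isOpen_isPathConnected_basis (p₁ e)).mem_iff.1 hT
  have hW : q₁.source ∩ p₁ ⁻¹' V ∈ 𝓝 e :=
    Filter.inter_mem (q₁.open_source.mem_nhds he₁) ((hVo.preimage cov₁.continuous).mem_nhds hxV)
  have key : ∀ e' ∈ q₁.source ∩ p₁ ⁻¹' V, f e' = q₂.symm (p₁ e') := by
    rintro e' ⟨he'₁, he'V⟩
    obtain ⟨c, hc⟩ := hVpc.joinedIn (p₁ e) hxV (p₁ e') he'V
    have h1 : (cov₁.monodromy (Path.Homotopic.Quotient.mk c) ⟨e, rfl⟩ : E₁) = e' := by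
      rw [monodromy_eq_symm_of_subset_target cov₁ q₁ hq₁ he₁ rfl c (fun t ↦ (hVT (hc t)).1)]
      have : q₁ e' = p₁ e' := by rw [hq₁]
      rw [← this, q₁.left_inv he'₁]
    have h1' : cov₁.monodromy (Path.Homotopic.Quotient.mk c) ⟨e, rfl⟩ = ⟨e', rfl⟩ := Subtype.ext h1
    have h2 := liftOfEquivariant_monodromy hφ (Path.Homotopic.Quotient.mk c) ⟨e, rfl⟩
    rw [h1'] at h2
    change f e' = _ at h2
    rw [h2]
    exact monodromy_eq_symm_of_subset_target cov₂ q₂ hq₂ he₂ hfe c (fun t ↦ (hVT (hc t)).2)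
  have hcont : ContinuousAt (fun e' ↦ q₂.symm (p₁ e')) e := by
    refine ContinuousAt.comp (q₂.continuousOn_symm.continuousAt (q₂.open_target.mem_nhds ?_))
      cov₁.continuous.continuousAt
    exact (hVT hxV).2
  exact hcont.congr (Filter.eventuallyEq_of_mem hW fun e' he' ↦ (key e' he').symm)

/-- The fibre map over `x₀` of the lift is `φ`. [cite: HatcherAT2002, §1.3 Prop. 1.33] -/
theorem fibreMap_liftOfEquivariant (hφ : ∀ γ : Path.Homotopic.Quotient x₀ x₀, Semiconj φ (cov₁.monodromy γ) (cov₂.monodromy γ)) :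
    fibreMap (liftOfEquivariant cov₁ cov₂ φ) liftOfEquivariant_spec x₀ = φ := by
  funext e
  ext
  simp only [fibreMap_coe, liftOfEquivariant_apply_fibre hφ]

/-- **THE FIBRE FUNCTOR IS FULLY FAITHFUL** (Hatcher Props. 1.33–1.34, Thm. 1.38 in morphism form):
over a path-connected, locally path-connected base, for covering maps `p₁, p₂` and every map of
fibres `φ : p₁⁻¹{x₀} → p₂⁻¹{x₀}` equivariant for the monodromy of loops at `x₀`, there is EXACTLY
ONE continuous `f : E₁ → E₂` over `X` whose fibre map over `x₀` is `φ`.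
[cite: HatcherAT2002, §1.3 Props. 1.33–1.34, Thm. 1.38] -/
theorem existsUnique_map_of_equivariant [LocallyPathConnectedSpace X] (hφ : ∀ γ : Path.Homotopic.Quotient x₀ x₀, Semiconj φ (cov₁.monodromy γ) (cov₂.monodromy γ)) :
    ∃! f : E₁ → E₂, Continuous f ∧ ∃ hf : ∀ e, p₂ (f e) = p₁ e, fibreMap f hf x₀ = φ := by
  refine ⟨liftOfEquivariant cov₁ cov₂ φ, ⟨continuous_liftOfEquivariant hφ, liftOfEquivariant_spec,
    fibreMap_liftOfEquivariant hφ⟩, ?_⟩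
  rintro g ⟨hgc, hg, hgφ⟩
  exact eq_of_fibreMap_eq cov₁ cov₂ hgc (continuous_liftOfEquivariant hφ) hg liftOfEquivariant_spec x₀
    (hgφ.trans (fibreMap_liftOfEquivariant hφ).symm)

end Full

/-! ### §4 Isomorphisms of covers from equivariant bijections of fibres -/

/-- Equivariance (`Function.Semiconj` for every loop class at `x₀`) passes to the inverse of an
equivariant bijection. [cite: HatcherAT2002, §1.3 Thm. 1.38] -/
theorem isEquivariant_symm {cov₁ : IsCoveringMap p₁} {cov₂ : IsCoveringMap p₂} {x₀ : X}
    {φ : p₁ ⁻¹' {x₀} ≃ p₂ ⁻¹' {x₀}} (hφ : ∀ γ : Path.Homotopic.Quotient x₀ x₀, Semiconj φ (cov₁.monodromy γ) (cov₂.monodromy γ)) :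
    ∀ γ : Path.Homotopic.Quotient x₀ x₀, Semiconj φ.symm (cov₂.monodromy γ) (cov₁.monodromy γ) := by
  intro γ e
  apply φ.injective
  rw [(hφ γ).eq, φ.apply_symm_apply, φ.apply_symm_apply]

section Iso

variable [PathConnectedSpace X] [LocallyPathConnectedSpace X] (cov₁ : IsCoveringMap p₁)
  (cov₂ : IsCoveringMap p₂) {x₀ : X}

/-- The lifts of `φ⁻¹` and `φ` compose to the identity (faithfulness).
[cite: HatcherAT2002, §1.3 Thm. 1.38] -/
theorem liftOfEquivariant_symm_comp (φ : p₁ ⁻¹' {x₀} ≃ p₂ ⁻¹' {x₀})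
    (hφ : ∀ γ : Path.Homotopic.Quotient x₀ x₀, Semiconj φ (cov₁.monodromy γ) (cov₂.monodromy γ)) :
    liftOfEquivariant cov₂ cov₁ φ.symm ∘ liftOfEquivariant cov₁ cov₂ φ = id :=
  eq_of_fibreMap_eq (p₂ := p₁) cov₁ cov₁
    ((continuous_liftOfEquivariant (isEquivariant_symm hφ)).comp (continuous_liftOfEquivariant hφ))
    continuous_id
    (fun e ↦ (liftOfEquivariant_spec (cov₁ := cov₂) (cov₂ := cov₁) _).trans (liftOfEquivariant_spec e))
    (fun _ ↦ rfl) x₀ (by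
      rw [fibreMap_comp (p₂ := p₂) _ liftOfEquivariant_spec _ liftOfEquivariant_spec,
        fibreMap_liftOfEquivariant hφ, fibreMap_liftOfEquivariant (isEquivariant_symm hφ), fibreMap_id]
      exact φ.symm_comp_self)

/-- **An equivariant BIJECTION of fibres is the fibre map of a homeomorphism over `X`**
(Hatcher Thm. 1.38: isomorphism classes of covers ↔ isomorphism classes of `π₁`-sets, injective
half): the lifts of `φ` and `φ⁻¹` are mutually inverse by faithfulness.
[cite: HatcherAT2002, §1.3 Thm. 1.38] -/
def homeomorphOfEquivariant (φ : p₁ ⁻¹' {x₀} ≃ p₂ ⁻¹' {x₀}) (hφ : ∀ γ : Path.Homotopic.Quotient x₀ x₀, Semiconj φ (cov₁.monodromy γ) (cov₂.monodromy γ)) :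
    E₁ ≃ₜ E₂ where
  toFun := liftOfEquivariant cov₁ cov₂ φ
  invFun := liftOfEquivariant cov₂ cov₁ φ.symm
  left_inv := congrFun (liftOfEquivariant_symm_comp cov₁ cov₂ φ hφ)
  right_inv := congrFun (liftOfEquivariant_symm_comp cov₂ cov₁ φ.symm (isEquivariant_symm hφ))
  continuous_toFun := continuous_liftOfEquivariant hφ
  continuous_invFun := continuous_liftOfEquivariant (isEquivariant_symm hφ)

/-- The homeomorphism lies over `X`. [cite: HatcherAT2002, §1.3 Thm. 1.38] -/
theorem homeomorphOfEquivariant_over (φ : p₁ ⁻¹' {x₀} ≃ p₂ ⁻¹' {x₀})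
    (hφ : ∀ γ : Path.Homotopic.Quotient x₀ x₀, Semiconj φ (cov₁.monodromy γ) (cov₂.monodromy γ)) (e : E₁) :
    p₂ (homeomorphOfEquivariant cov₁ cov₂ φ hφ e) = p₁ e :=
  liftOfEquivariant_spec e

/-- Its fibre map over `x₀` is `φ`. [cite: HatcherAT2002, §1.3 Thm. 1.38] -/
theorem fibreMap_homeomorphOfEquivariant (φ : p₁ ⁻¹' {x₀} ≃ p₂ ⁻¹' {x₀})
    (hφ : ∀ γ : Path.Homotopic.Quotient x₀ x₀, Semiconj φ (cov₁.monodromy γ) (cov₂.monodromy γ)) :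
    fibreMap (homeomorphOfEquivariant cov₁ cov₂ φ hφ) (homeomorphOfEquivariant_over cov₁ cov₂ φ hφ) x₀
      = φ :=
  fibreMap_liftOfEquivariant hφ

/-- **Two covers with equivariantly isomorphic fibres are isomorphic over `X`** (existence form).
[cite: HatcherAT2002, §1.3 Thm. 1.38] -/
theorem exists_homeomorph_of_equivariant (φ : p₁ ⁻¹' {x₀} ≃ p₂ ⁻¹' {x₀})
    (hφ : ∀ γ : Path.Homotopic.Quotient x₀ x₀, Semiconj φ (cov₁.monodromy γ) (cov₂.monodromy γ)) :
    ∃ h : E₁ ≃ₜ E₂, (∀ e, p₂ (h e) = p₁ e) ∧ ∀ e : p₁ ⁻¹' {x₀}, (h e : E₂) = φ e :=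
  ⟨homeomorphOfEquivariant cov₁ cov₂ φ hφ, homeomorphOfEquivariant_over cov₁ cov₂ φ hφ,
    fun e ↦ congrArg Subtype.val (congrFun (fibreMap_homeomorphOfEquivariant cov₁ cov₂ φ hφ) e)⟩

end Iso

end CoverMorphism

end Literature.Topology.CoveringSpaces
end
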